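/-
Copyright (c) 2026 the pub-hodgecm-mathlib formalisation cell (harness21).  Prover seat hodgecm-mathlib-K2E1-p11 (g2), Track B ∕ K2-LIT, h413 =
`stmt-HodgeConjecture-24833`, line `K2_E1_TraceFormulaBeta`, 5Res campaign «ENDGAME BY FAMILIES» ∕ ROADCARD §3′ (M2 v2), deal (255)∕(257) (y1-a): the EXPLICIT residue Gram model
`r_i = (√C • R_c^{1/2} w_{i,c})_c` of ★ 4a `K2E1PositiveResidueGramModel` EXPORTED (not just `∃ r` with the total Gram), and the PER-ATOM GENERATOR RELATION it affords: if the residue data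
scale, `w_{τ i, c} = s(c) • w_{i,c}`, then `r_{τ i} = diag(s) r_i` — the residue half of the self-dual `hU` (y1-c).  Mathlib + ★ 4a.
-/
import Summits.HodgeConjecture.HodgeConjecture.Theorems.K2E1PositiveResidueGramModel    -- ★ 4a p860298 (K2E4-p10): `inner_sqrt_sqrt_eq`
import HarnessLib

/-!
# (y1-a) — `K2E1PositiveResidueGramModelExplicit`: the explicit residue model `r_i = (√C • R_c^{1/2} w_{i,c})_c` and the per-atom relation `r_{τ i} = diag(s)·r_i`

Cell `pub/hodgecm-mathlib`, crux H413 = `stmt-HodgeConjecture-24833`, route `HCCMUnconditional`; dealer K2E1-plan (g7) rulings (255)∕(257) ((y1): «residue coordinate by the PER-ATOM route»).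
THEOREMS ONLY (no `def` ∕ `instance` ∕ `notation` ∕ named-fact hypothesis ∕ `sorry`); lane `--kind proof --supports stmt-HodgeConjecture-24833 --as helper` (count-neutral; closes no socket).
THE MATHEMATICS ([ReedSimonI1980, Thm. VI.9]; [MoeglinWaldspurger1995, IV.3.12, II.2.4]).  ★ 4a proves `∃ r : ι → ⊕_c V, ⟪r_i, r_j⟫ = C·Σ_c ⟪w_{i,c}, R_c w_{j,c}⟫` with the witness
`r_i c := √C • R_c^{1/2} w_{i,c}` hidden in the proof; the self-dual `hU` of D5′ needs the witness ITSELF, because the Hecke symbol acts on the residue atom `c` by the SCALAR `s(c)`: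
`R_c^{1/2}` is LINEAR, so `w_{τ i, c} = s(c) • w_{i,c}` ⟹ `r_{τ i} c = s(c) • r_i c` (§2), i.e. `r_{τ i} = (s(c)•r_i c)_c`.  §1 re-exports ★ 4a with the explicit clause; §3 the
`Finset ℝ` ∕ linear-`R` prints in ★ 4a's currencies.
* §1 **`exists_gram_of_isPositive_explicit`**.  * §2 **`residue_generator_relation`**, `residue_generator_relation'`.  * §3 **`exists_gram_of_isPositive_finset_explicit`**, **`exists_gram_of_nonneg_finset_explicit`**.
HONEST LABEL.  Count-neutral helper; proves no printed statement; Mathlib + ★ 4a only.  HC_CM is proved only modulo the 7 printed citations (2 remaining named inputs: hLiu418 =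
`stmt-HodgeConjecture-24832`, h413 = `stmt-HodgeConjecture-24833`) until rung 0 closes.

## References
* [ReedSimonI1980] M. Reed, B. Simon, *Methods of Modern Mathematical Physics I* (1980), Thm. VI.9 (square root lemma).
* [MoeglinWaldspurger1995] C. Mœglin, J.-L. Waldspurger, *Spectral decomposition and Eisenstein series* (1995), II.2.4, IV.3.12.
-/

set_option autoImplicit false
-- the mandated namespace repeats `HodgeConjecture.HodgeConjecture`, as in every `Theorems/*.lean` of this sub-problem
set_option linter.dupNamespace false

noncomputable section

open scoped InnerProductSpace ComplexConjugate BigOperators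
open Summit.HodgeConjecture.HodgeConjecture.Cruxes.H413.K2E1PositiveResidueGramModel (inner_sqrt_sqrt_eq)

namespace Summit.HodgeConjecture.HodgeConjecture.Cruxes.H413.K2E1PositiveResidueGramModelExplicit

variable {V : Type*} [NormedAddCommGroup V] [InnerProductSpace ℂ V] [CompleteSpace V]

/-! ## §1 The explicit Gram model -/

/-- **THE EXPLICIT RESIDUE GRAM MODEL** (★ 4a `exists_gram_of_isPositive` with its witness exported): `r_i c = √C • R_c^{1/2} w_{i,c}` AND `⟪r_i, r_j⟫ = C·Σ_c ⟪w_{i,c}, R_c w_{j,c}⟫`.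
[cite: ReedSimonI1980, Thm. VI.9] [cite: MoeglinWaldspurger1995, IV.3.12] -/
theorem exists_gram_of_isPositive_explicit {ι γ : Type*} [Fintype γ] (R : γ → V →L[ℂ] V) (hR : ∀ c, (R c).IsPositive) (w : ι → γ → V) {C : ℝ} (hC : 0 ≤ C) :
    ∃ r : ι → PiLp 2 (fun _ : γ => V), (∀ i c, r i c = ((Real.sqrt C : ℝ) : ℂ) • CFC.sqrt (R c) (w i c)) ∧
      ∀ i j, ⟪r i, r j⟫_ℂ = (C : ℂ) * ∑ c, ⟪w i c, R c (w j c)⟫_ℂ := by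
  refine ⟨fun i => WithLp.toLp 2 fun c => ((Real.sqrt C : ℝ) : ℂ) • CFC.sqrt (R c) (w i c), fun i c => rfl, fun i j => ?_⟩
  rw [PiLp.inner_apply, Finset.mul_sum]
  refine Finset.sum_congr rfl fun c _ => ?_
  show ⟪((Real.sqrt C : ℝ) : ℂ) • CFC.sqrt (R c) (w i c), ((Real.sqrt C : ℝ) : ℂ) • CFC.sqrt (R c) (w j c)⟫_ℂ = _
  rw [inner_smul_left, inner_smul_right, Complex.conj_ofReal, ← mul_assoc, ← Complex.ofReal_mul, Real.mul_self_sqrt hC, inner_sqrt_sqrt_eq (R c) (hR c)]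

/-! ## §2 The per-atom generator relation `r_{τ i} c = s(c) • r_i c` -/

/-- **THE PER-ATOM GENERATOR RELATION**: in the explicit model, if the residue data of two indices scale atomwise — `w_{j,c} = s(c) • w_{i,c}` for all `c` (E1: `j = τ i`, `s` the Hecke
symbol, `w_{i,c} = Ψ̂_i(−c)` and `mellin g(−c) = s(c)·mellin f(−c)` ★ `mellin_smoothingProfile`) — then `r_j c = s(c) • r_i c` for every atom (`R_c^{1/2}` is linear): the residue
coordinate of `U(R(h)θ)` is the diagonal operator `D_s` applied to that of `U θ`. [cite: MoeglinWaldspurger1995, II.2.4, IV.3.12] -/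
theorem residue_generator_relation {ι γ : Type*} [Fintype γ] {R : γ → V →L[ℂ] V} {w : ι → γ → V} {C : ℝ} {r : ι → PiLp 2 (fun _ : γ => V)}
    (hr : ∀ i c, r i c = ((Real.sqrt C : ℝ) : ℂ) • CFC.sqrt (R c) (w i c)) {s : γ → ℂ} {i j : ι} (hw : ∀ c, w j c = s c • w i c) (c : γ) :
    r j c = s c • r i c := by
  rw [hr j c, hr i c, hw c, map_smul, smul_comm]

/-- The same as an identity in `⊕_c V`: `r_j = (s(c) • r_i c)_c`. [cite: MoeglinWaldspurger1995, II.2.4] -/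
theorem residue_generator_relation' {ι γ : Type*} [Fintype γ] {R : γ → V →L[ℂ] V} {w : ι → γ → V} {C : ℝ} {r : ι → PiLp 2 (fun _ : γ => V)}
    (hr : ∀ i c, r i c = ((Real.sqrt C : ℝ) : ℂ) • CFC.sqrt (R c) (w i c)) {s : γ → ℂ} {i j : ι} (hw : ∀ c, w j c = s c • w i c) :
    r j = WithLp.toLp 2 (fun c => s c • r i c) := by
  ext c
  exact residue_generator_relation hr hw c

/-! ## §3 The `Finset ℝ` and linear-`R` prints (★ 4a's currencies) -/

/-- **EXPLICIT MODEL, `Finset ℝ` PRINT** (★ 4a `exists_gram_of_isPositive_finset` with the witness exported). [cite: MoeglinWaldspurger1995, IV.3.12] -/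
theorem exists_gram_of_isPositive_finset_explicit {ι : Type*} (S : Finset ℝ) (R : ℝ → V →L[ℂ] V) (hR : ∀ c ∈ S, (R c).IsPositive) (w : ι → ℝ → V) {C : ℝ} (hC : 0 ≤ C) :
    ∃ r : ι → PiLp 2 (fun _ : ↥S => V), (∀ i (c : ↥S), r i c = ((Real.sqrt C : ℝ) : ℂ) • CFC.sqrt (R c) (w i c)) ∧
      ∀ i j, ⟪r i, r j⟫_ℂ = (C : ℂ) * ∑ c ∈ S, ⟪w i c, R c (w j c)⟫_ℂ := by
  obtain ⟨r, hr, hG⟩ := exists_gram_of_isPositive_explicit (fun c : ↥S => R c) (fun c => hR c c.2) (fun i (c : ↥S) => w i c) hC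
  refine ⟨r, hr, fun i j => ?_⟩
  rw [hG i j, ← Finset.sum_coe_sort S]

/-- **EXPLICIT MODEL, LINEAR-`R` PRINT** (★ 4a `exists_gram_of_nonneg_finset`'s currency: `R : ℝ → V →ₗ[ℂ] V` on a finite-dimensional `V`, symmetric with `0 ≤ re ⟪v, R_c v⟫`).
[cite: MoeglinWaldspurger1995, IV.3.12] -/
theorem exists_gram_of_nonneg_finset_explicit [FiniteDimensional ℂ V] {ι : Type*} (S : Finset ℝ) (R : ℝ → V →ₗ[ℂ] V)
    (hRsymm : ∀ c ∈ S, ∀ x y : V, ⟪x, R c y⟫_ℂ = ⟪R c x, y⟫_ℂ) (hRpos : ∀ c ∈ S, ∀ v : V, 0 ≤ RCLike.re ⟪v, R c v⟫_ℂ) (w : ι → ℝ → V) {C : ℝ} (hC : 0 ≤ C) :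
    ∃ r : ι → PiLp 2 (fun _ : ↥S => V), (∀ i (c : ↥S), r i c = ((Real.sqrt C : ℝ) : ℂ) • CFC.sqrt (LinearMap.toContinuousLinearMap (R c)) (w i c)) ∧
      ∀ i j, ⟪r i, r j⟫_ℂ = (C : ℂ) * ∑ c ∈ S, ⟪w i c, R c (w j c)⟫_ℂ := by
  have hpos : ∀ c ∈ S, (LinearMap.toContinuousLinearMap (R c)).IsPositive := fun c hc => by
    refine ⟨fun x y => ?_, fun v => ?_⟩
    · simpa using (hRsymm c hc x y).symm
    · have h := hRpos c hc v
      rw [hRsymm c hc v v] at h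
      simpa [ContinuousLinearMap.reApplyInnerSelf] using h
  obtain ⟨r, hr, hG⟩ := exists_gram_of_isPositive_finset_explicit S (fun c => LinearMap.toContinuousLinearMap (R c)) hpos w hC
  exact ⟨r, hr, fun i j => by simpa using hG i j⟩

end Summit.HodgeConjecture.HodgeConjecture.Cruxes.H413.K2E1PositiveResidueGramModelExplicit

end
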